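import Literature.Computability.Complexity.TableauSnapshotsProofs
import Literature.Computability.Complexity.Williams2014Lemma31
import Literature.Computability.Complexity.CodeFPLists
import Literature.Computability.Complexity.CodeFPArith
import Literature.Computability.Complexity.TimeBoundsProofs
import Literature.Computability.Complexity.Williams2014SatInstanceFP
import Literature.Computability.Complexity.StackWords
import HarnessLib

/-!
# Williams' generator `A` (Lemma 3.1), part 1: the clause-bit machine and its tableau circuits

R. Williams, *Nonuniform ACC circuit lower bounds*, J. ACM 61 (2014), Lemma 3.1 (pp. 10–12):
"there is a nondeterministic algorithm `A` which on `x` … prints an `ACC` circuit `C'ₓ` equivalent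
to the clause circuit `Cₓ` of Fact 3.1 … `A` guesses `ACC` circuits encoding the gate values of
`Cₓ` [here: the tableau of the polynomial-time computation of the clause bits] and verifies them
with calls of the `ACC`-SAT algorithm on the circuit VALUE". This file is the first layer of the
tree's machine `A` for the named fact `Williams2014_lemma_3_1` (`Williams2014Lemma31.lean`), over
the succinct reductions `cl` of `Williams2014Transfer.lean` and the Cook–Levin tableau of
`CookLevinTableau.lean` / `TableauSnapshots.lean`:

* **the clause-bit machine** `M_f`: ONE bundled machine deciding, on the word
  `⟨⟨x, ⟨code κ, [pol]⟩⟩, u⟩` (`xq`, fixed-length coordinate codes `coordCode`), the bit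
  `clauseMap w (cl x) i κ ⊕ pol` of the clause presented at the index `i` with binary digits `u`
  (`bitFun`, `bitFun_xq`); it is obtained WITHOUT writing a machine, from the polynomial-time
  clause function of the reduction (`IsSuccinctReduction.polyTimeComputable`) composed in the
  typed form `PolyTimeComputable.comp_holds` with decoders of the tree's `CodeFP` calculus
  (`codeFP_bitFun`, `exists_bitMachine`) — the polarity bit `pol` makes the SAME machine accept
  the inputs with clause bit `1` (`pol = 0`) and those with clause bit `0` (`pol = 1`), so that
  the accept clause of the Cook–Levin tableau can be used on both sides (`clauseMap_eq_of_checks`);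
* **its tableau circuits under "`P` has `ACC` circuits"** (`exists_tableauCircuits_acc`): the
  circuits `E` of the printed proof ("by assumption, this problem also has `ACC` circuits"), here
  for the modulus and depth of the hypothesis `PHasAccCircuits m d` of `Williams2014_lemma_3_1`
  (the tree's `Tableau.exists_tableauCircuits` produces them from `P ⊆ ACC⁰` with its own modulus),
  from the proved fact `Tableau.snapshot_mem_P_holds` (`TableauSnapshotsProofs.lean`);
* **the soundness core of `A`** (`clauseMap_eq_of_checks`): if, for an input `u`, a bit `g`
  guards the Cook–Levin clauses and the pins (`Tableau.Pinned`) of the run of `M_f` on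
  `⟨x'_{κ,0}, u⟩` when `g = 1` and of the run on `⟨x'_{κ,1}, u⟩` when `g = 0`, then `g` is the
  clause bit (`Tableau.accepts_of_pinned` on the active side) — the content of "if VALUE is
  unsatisfiable then the guessed circuits are correct"; and the value of the intended tableau
  assignment at the output cell (`intended_outVar`), for completeness.

No new named fact; everything here is proved.

## References

* R. Williams, *Nonuniform ACC circuit lower bounds*, J. ACM 61 (2014) 2:1–2:32, Lemma 3.1 and its
  proof (pp. 10–12) [Williams2014].
* S. Arora, B. Barak, *Computational Complexity: A Modern Approach*, CUP 2009, §1.3 (composition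
  of polynomial-time computations), Thm. 6.6 (`P ⊆ P/poly`, circuits from a computation)
  [AroraBarakCC2009].
* M. Sipser, *Introduction to the Theory of Computation*, 3rd ed. 2012, Thm. 7.37 (tableau)
  [Sipser2012].
-/

noncomputable section

namespace Literature.Computability.Complexity

open Turing _root_.Computability Polynomial CodeFP Brick

namespace MachineA

/-! ### Padded binary numerals and fixed-length coordinate codes -/

/-- The binary numeral of `t` (least significant digit first, Mathlib's `encodeNat`) padded with
high zeros to length `L` (for `t ≤ L`); read back by the padding-tolerant `bitsToNat`. [folklore] -/
def natPad (t L : ℕ) : List Bool := natE t ++ List.replicate (L - (natE t).length) false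

/-- The padded numeral has the right value. [folklore] -/
@[simp] theorem bitsToNat_natPad (t L : ℕ) : bitsToNat (natPad t L) = t := by
  rw [natPad, bitsToNat_append, bitsToNat_replicate_false, mul_zero, add_zero, bitsToNat_encodeNat]

/-- The padded numeral has length `L` when `t ≤ L`. [folklore] -/
theorem length_natPad {t L : ℕ} (h : t ≤ L) : (natPad t L).length = L := by
  have := length_natE_le t
  simp only [natPad, List.length_append, List.length_replicate]
  omega

/-- The field number of a clause coordinate field: `0` occupancy, `1` polarity, `j + 2` index bit
`j`. [folklore] -/
def fieldNum {w : ℕ} : Bool ⊕ Fin w → ℕ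
  | Sum.inl false => 0
  | Sum.inl true => 1
  | Sum.inr j => (j : ℕ) + 2

/-- Field numbers are at most `w + 1`. [folklore] -/
theorem fieldNum_le {w : ℕ} (f : Bool ⊕ Fin w) : fieldNum f ≤ w + 1 := by
  rcases f with (_ | _) | j
  · simp [fieldNum]
  · simp [fieldNum]
  · simp only [fieldNum]; omega

/-- **The fixed-length code of a clause coordinate** `κ = (ℓ, f)` at width `w`:
`⟨bin₂ ℓ, bin_{w+2} (fieldNum f)⟩`, of length `w + 8`. [folklore] -/
def coordCode (w : ℕ) (κ : ClauseCoord w) : List Bool :=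
  boolPair (natPad κ.1 2) (natPad (fieldNum κ.2) (w + 2))

/-- The coordinate code has length `w + 8`. [folklore] -/
theorem length_coordCode {w : ℕ} (κ : ClauseCoord w) : (coordCode w κ).length = w + 8 := by
  have h1 : (κ.1 : ℕ) ≤ 2 := by have := κ.1.isLt; omega
  rw [coordCode, length_boolPair, length_natPad h1, length_natPad (by have := fieldNum_le κ.2; omega)]
  omega

/-- **The instance word `x'_{κ,pol} = ⟨x, ⟨code κ, [pol]⟩⟩`** of the clause-bit machine for input
`x`, coordinate `κ` (at width `w = succinctWidth c |x|`) and polarity `pol`. [cite: Williams2014, Lemma 3.1 (proof)] -/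
def xq (c : ℕ) (x : List Bool) (κ : ClauseCoord (succinctWidth c x.length)) (pol : Bool) : List Bool :=
  boolPair x (boolPair (coordCode _ κ) [pol])

/-- All instance words of `x` have the same length `2|x| + 2w + 21`. [folklore] -/
theorem length_xq (c : ℕ) (x : List Bool) (κ : ClauseCoord (succinctWidth c x.length)) (pol : Bool) :
    (xq c x κ pol).length = 2 * x.length + 2 * succinctWidth c x.length + 21 := by
  simp only [xq, length_boolPair, length_coordCode, List.length_singleton]
  ring

/-! ### The clause-bit function -/

/-- The untyped clause bit: field `t` of literal slot `ℓ` of the clause `C` — occupancy for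
`t = 0`, polarity for `t = 1`, bit `min cap (t - 2)` of the variable for `t ≥ 2` (the cap keeps
the string function polynomial on every input). [cite: Williams2014, §3 (p. 9)] -/
def bitOf (C : Clause ℕ) (ℓ t cap : ℕ) : Bool :=
  if t = 0 then decide (ℓ < C.length)
  else if t = 1 then (C.litD ℓ).2 else (C.litD ℓ).1.testBit (min (t - 2) cap)

/-- The typed clause bit is the untyped one at the field number (cap at least `w - 1`). [folklore] -/
theorem clauseBit_eq_bitOf {w : ℕ} (C : Clause ℕ) (κ : ClauseCoord w) {cap : ℕ} (hcap : w ≤ cap + 1) :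
    clauseBit w C κ = bitOf C κ.1 (fieldNum κ.2) cap := by
  obtain ⟨ℓ, (_ | _) | j⟩ := κ
  · simp [clauseBit, bitOf, fieldNum]
  · simp [clauseBit, bitOf, fieldNum]
  · have hj : min (j : ℕ) cap = j := min_eq_left (by have := j.isLt; omega)
    simp [clauseBit, bitOf, fieldNum, hj]

/-- `bitsToNat` of the digit list of a cube point is its number `bitsVal`. [folklore] -/
theorem bitsToNat_ofFn {w : ℕ} (i : Fin w → Bool) : bitsToNat (List.ofFn i) = bitsVal i := by
  refine Nat.eq_of_testBit_eq fun j => ?_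
  rw [testBit_bitsToNat_eq_getD]
  by_cases hj : j < w
  · rw [List.getD_eq_getElem _ _ (by simpa using hj), List.getElem_ofFn]
    exact (testBit_bitsVal i ⟨j, hj⟩).symm
  · rw [List.getD_eq_default _ _ (by simpa using Nat.le_of_not_lt hj)]
    symm
    apply Nat.testBit_eq_false_of_lt
    exact (bitsVal_lt i).trans_le (Nat.pow_le_pow_right (by norm_num) (Nat.le_of_not_lt hj))

/-- **The clause-bit function** of the clause function `cl` on raw words
`z = ⟨⟨x, ⟨⟨lc, tc⟩, pc⟩⟩, u⟩`: the bit `bitOf (cl x (val u)) (val lc) (val tc) |tc|`, flipped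
when `pc = [1]` (all projections total: `fstF`/`sndF`, `bitsToNat`). [cite: Williams2014, Lemma 3.1 (proof)] -/
def bitFun (cl : List Bool → ℕ → Clause ℕ) (z : List Bool) : Bool :=
  xor (bitOf (cl (fstF (fstF z)) (bitsToNat (sndF z))) (bitsToNat (fstF (fstF (sndF (fstF z)))))
      (bitsToNat (sndF (fstF (sndF (fstF z))))) (sndF (fstF (sndF (fstF z)))).length)
    (decide (sndF (sndF (fstF z)) = [true]))

/-- **The clause-bit function on an instance word**: on `⟨x'_{κ,pol}, digits of i⟩` it is the
coordinate `κ` of the clause map of `cl x` at `i`, flipped by `pol`. [cite: Williams2014, Lemma 3.1 (proof)] -/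
theorem bitFun_xq (cl : List Bool → ℕ → Clause ℕ) (c : ℕ) (x : List Bool)
    (κ : ClauseCoord (succinctWidth c x.length)) (pol : Bool) (i : Fin (succinctWidth c x.length) → Bool) :
    bitFun cl (boolPair (xq c x κ pol) (List.ofFn i)) = xor (clauseMap _ (cl x) i κ) pol := by
  have hcap : (natPad (fieldNum κ.2) (succinctWidth c x.length + 2)).length = succinctWidth c x.length + 2 :=
    length_natPad (by have := fieldNum_le κ.2; omega)
  simp only [bitFun, xq, coordCode, fstF_boolPair, sndF_boolPair, bitsToNat_natPad, bitsToNat_ofFn, hcap,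
    clauseMap]
  rw [← clauseBit_eq_bitOf _ _ (by omega)]
  cases pol <;> simp

/-! ### The clause-bit function is polynomial time (typed calculus) -/

/-- The Boolean code of a clause is the calculus code `listE (pairE natE bitE)`. [folklore] -/
theorem encodingClause_encode (C : Clause ℕ) : encodingClause.encode C = listE (pairE natE bitE) C := by
  rw [encodingClause, CodeFP.listE_eq, encodingLiteral, CodeFP.pairE_eq, CodeFP.natE_eq, CodeFP.bitE_eq]

/-- **The clause function behind a total query map is in the calculus**: if `ψ : {0,1}* → {0,1}* × ℕ`
is computed on raw words, then so is `z ↦ cl (ψ z)` (clause code `listE (pairE natE bitE)`); the query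
word handed to the clause machine is always genuine, so the typed composition
`PolyTimeComputable.comp_holds` applies (cf. `clauseFn_mem_FP`, `ClauseTableChecker.lean`).
[cite: AroraBarakCC2009, §1.3] -/
theorem codeFP_clause {cl : List Bool → ℕ → Clause ℕ}
    (hcl : PolyTimeComputable encodeClauseQuery encodingClause.encode (Function.uncurry cl))
    {ψ : List Bool → List Bool × ℕ} (hψ : CodeFP strE (CodeFP.pairE strE natE) ψ) :
    CodeFP strE (listE (CodeFP.pairE natE bitE)) (fun z => cl (ψ z).1 (ψ z).2) := by
  obtain ⟨F, hF, hFψ⟩ := hψ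
  have hψ' : PolyTimeComputable (id : List Bool → List Bool) encodeClauseQuery ψ :=
    hF.of_encode (F := F) (g := id) (fun _ => rfl) fun z => by
      rw [id, hFψ]; rfl
  have hcomp := PolyTimeComputable.comp_holds hcl hψ'
  obtain ⟨p, M, hM⟩ := hcomp
  refine ⟨fun z => listE (CodeFP.pairE natE bitE) (cl (ψ z).1 (ψ z).2), ⟨p, M, fun z => ?_⟩, fun _ => rfl⟩
  have := hM z
  simp only [Function.comp, Function.uncurry, encodingClause_encode] at this
  simpa using this

open CodeFP in
/-- **The clause-bit function is in the calculus** (hence polynomial time on every raw word).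
Composites are built bottom-up without expected types (elaboration discipline of
`Williams2014SatInstanceFP.lean`) and matched to `bitFun` at the end. [cite: AroraBarakCC2009, §1.3] -/
theorem codeFP_bitFun {cl : List Bool → ℕ → Clause ℕ}
    (hcl : PolyTimeComputable encodeClauseQuery encodingClause.encode (Function.uncurry cl)) :
    CodeFP strE bitE (bitFun cl) := by
  have h1 : CodeFP strE strE fstF := of_fn fstF fstF_mem_FP fun _ => rfl
  have h2 : CodeFP strE strE sndF := of_fn sndF sndF_mem_FP fun _ => rfl
  have hinj : Function.Injective strE := fun _ _ h => h
  -- the projections of `z = ⟨⟨x, ⟨⟨lc, tc⟩, pc⟩⟩, u⟩`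
  have hx := h1.comp h1
  have hkp := h2.comp h1
  have hkc := h1.comp hkp
  have hpc := h2.comp hkp
  have hlc := h1.comp hkc
  have htc := h2.comp hkc
  -- the clause (raw list code) and the numbers read off the coordinate code
  have hψ := hx.pair (strVal.comp h2)
  have hC := (rawOfList (pairE natE bitE)).comp (codeFP_clause hcl hψ)
  have hℓ := strVal.comp hlc
  have ht := strVal.comp htc
  have hj := unOfNatMin.comp ((strLength.comp htc).pair (natSub.comp (ht.pair (SatCode.cst strE natE (2 : ℕ)))))
  have hlit := (rawGetOr (pairE natE bitE)).comp (hC.pair (hℓ.pair (SatCode.cst strE (pairE natE bitE) ((0 : ℕ), false))))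
  have hv := hlit.fst'
  have hsg := hlit.snd'
  -- the index bit `v.testBit j = ((v / 2 ^ j) % 2 = 1)`, the occupancy bit, the field tests
  have hpow := natPow.comp ((SatCode.cst strE natE (2 : ℕ)).pair hj)
  have hbit := natEq.comp ((natMod.comp ((natDiv.comp (hv.pair hpow)).pair
    (SatCode.cst strE natE (2 : ℕ)))).pair (SatCode.cst strE natE (1 : ℕ)))
  have hocc := natLt.comp (hℓ.pair ((natLength (pairE natE bitE)).comp hC))
  have ht0 := natEq.comp (ht.pair (SatCode.cst strE natE (0 : ℕ)))
  have ht1 := natEq.comp (ht.pair (SatCode.cst strE natE (1 : ℕ)))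
  have hpol := (CodeFP.eq hinj).comp (hpc.pair (SatCode.cst strE strE [true]))
  have hmain := (ht0.ite hocc (ht1.ite hsg hbit)).xor hpol
  refine hmain.congr fun z => ?_
  simp only [bitFun, bitOf, Clause.litD, Nat.testBit_eq_decide_div_mod_eq, decide_eq_true_eq]
  rfl

/-- **The clause-bit machine**: a bundled machine printing `[bitFun cl z]` on every raw word `z`
within polynomially many steps. [cite: Williams2014, Lemma 3.1 (proof)] -/
theorem exists_bitMachine {cl : List Bool → ℕ → Clause ℕ}
    (hcl : PolyTimeComputable encodeClauseQuery encodingClause.encode (Function.uncurry cl)) :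
    ∃ (M : TM2ComputableAux Bool Bool) (p : Polynomial ℕ),
      ∀ z : List Bool, M.OutputsWithin z [bitFun cl z] (p.eval z.length) := by
  obtain ⟨F, ⟨p, M, hM⟩, hF⟩ := codeFP_bitFun hcl
  exact ⟨M, p, fun z => by have := hM z; rwa [show F z = [bitFun cl z] from hF z] at this⟩

end MachineA

/-! ### Tableau circuits under "`P` has `ACC` circuits of depth `d`" -/

namespace Tableau

attribute [local instance] Turing.FinTM2.kFin Turing.FinTM2.ΛFin Turing.FinTM2.σFin
  Turing.FinTM2.Γk₀Fin

/-- **Snapshot circuits for a prescribed modulus and depth**: under `PHasAccCircuits m d` (every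
language of `P` has `accBasis m`-circuits of depth `d` and polynomial size), for every bundled
machine `M` ONE polynomial `q` bounds, for every word `x'`, certificate length `P`, bounds `T`, `S`
and `t ≤ T`, `J ≤ S`, value `v`, an `accBasis m`-circuit of depth `≤ d + 1` on the certificate bits
deciding whether block `J` of configuration `t` of `M` on `⟨x', u⟩` is `v` (the tree's
`exists_snapshotCircuits` with the class supplied by `PHasAccCircuits` instead of `P ⊆ ACC⁰`, and
the snapshot language in `P` by the theorem `snapshot_mem_P_holds`).
[cite: Williams2014, Lemma 3.1 (proof)] -/
theorem exists_snapshotCircuits_acc {m d : ℕ} (hP : PHasAccCircuits m d)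
    (M : TM2ComputableAux Bool Bool) :
    ∃ q : Polynomial ℕ, ∀ (x' : List Bool) (P T S t J : ℕ) (v : Val M.tm),
      t ≤ T → J ≤ S → ∃ E : Circuit (Fin P), E.IsOver (accBasis m) ∧ E.acDepth ≤ d + 1 ∧
        E.size ≤ q.eval (x'.length + P + T + S) ∧
        ∀ u : Fin P → Bool,
          (E.eval u = true ↔ absVal (cfgOf M (boolPair x' (List.ofFn u)) t) J = v) := by
  classical
  have hL := hP (snapshot_mem_P_holds M)
  simp only [Set.mem_iUnion] at hL
  obtain ⟨q, C, hC, hdec⟩ := hL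
  set V : ℕ := Nat.card (Val M.tm) with hV
  refine ⟨q.comp (4 * X + Polynomial.C (V + 10)) + 2, fun x' P T S t J v ht hJ => ?_⟩
  set vn : ℕ := ((valEquiv M) v : ℕ) with hvn
  have hvV : vn < V := ((valEquiv M) v).isLt
  let τ : Template P := snapTemplate x' P t T J S vn V
  have hτlen : τ.length = 4 * x'.length + 2 * P + 2 * T + 2 * S + V + 10 :=
    length_snapTemplate x' ht hJ hvV.le
  obtain ⟨E, hEB, hEs, hEd, hEe⟩ := hdec.exists_circuit_fill (B := accBasis m)
    (acBasis_subset_accBasis m (or_mem_acBasis 0)) (acBasis_subset_accBasis m (and_mem_acBasis 0))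
    τ (hC τ.length).1
  refine ⟨E, hEB, hEd.trans (Nat.add_le_add_right (hC τ.length).2.1 1), hEs.trans ?_, fun u => ?_⟩
  · have h1 : (C τ.length).size ≤ q.eval τ.length := (hC τ.length).2.2
    have h2 : τ.length ≤ 4 * (x'.length + P + T + S) + (V + 10) := by rw [hτlen]; omega
    have h3 := natPoly_eval_mono q h2
    simp only [eval_add, eval_comp, eval_mul, eval_ofNat, eval_X, eval_C]
    omega
  · rw [hEe u]
    have hfill : τ.fill u = snapQuery (boolPair x' (List.ofFn u)) t T J S vn V :=
      fill_snapTemplate x' P t T J S vn V u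
    rw [hfill]
    have key : snapQuery (boolPair x' (List.ofFn u)) t T J S vn V ∈ snapshotLang M ↔
        absVal (cfgOf M (boolPair x' (List.ofFn u)) t) J = v := by
      rw [snapQuery_mem_iff _ hvV]
      have : (valEquiv M).symm ⟨vn, hvV⟩ = v := by
        rw [Equiv.symm_apply_eq]
      rw [this]
    rw [← key]
    exact (Set.mem_iff_boolIndicator _ _).symm

/-- **Tableau-variable circuits for a prescribed modulus and depth** (Williams 2014, proof of
Lemma 3.1: the circuits `E` encoding the tableau, "by assumption, this problem also has `ACC`
circuits"): under `PHasAccCircuits m d`, ONE polynomial `q` such that for every instance `x'`,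
certificate length `P`, time bound `T`, row `t ≤ T`, block `J ≤ S₁` and value `v`, an
`accBasis m`-circuit of depth `≤ d + 1` and size `≤ q(|x'| + P + T)` on the certificate bits computes
the intended truth value of the tableau variable `(blk t J, v)` of the run of `M` on `⟨x', u⟩`.
[cite: Williams2014, Lemma 3.1 (proof)] -/
theorem exists_tableauCircuits_acc {m d : ℕ} (hP : PHasAccCircuits m d)
    (M : TM2ComputableAux Bool Bool) :
    ∃ q : Polynomial ℕ, ∀ (x' : List Bool) (P T t J : ℕ) (v : Val M.tm),
      t ≤ T → J ≤ S1 M x'.length P T → ∃ E : Circuit (Fin P), E.IsOver (accBasis m) ∧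
        E.acDepth ≤ d + 1 ∧ E.size ≤ q.eval (x'.length + P + T) ∧
        ∀ u : Fin P → Bool,
          E.eval u = intended (M := M) x' P T (List.ofFn u) (blk M x'.length P T t J, v) := by
  obtain ⟨q, h⟩ := exists_snapshotCircuits_acc hP M
  set dd : ℕ := dM M with hdd
  refine ⟨q.comp (Polynomial.C (dd + 3) * X + Polynomial.C (3 * dd + 2)), fun x' P T t J v ht hJ => ?_⟩
  obtain ⟨E, hEB, hEd, hEs, hEe⟩ := h x' P T (S1 M x'.length P T) t J v ht hJ
  refine ⟨E, hEB, hEd, hEs.trans ?_, fun u => ?_⟩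
  · have hS : S1 M x'.length P T = 2 * x'.length + 2 + P + dd * T + 3 * dd := rfl
    have h2 : x'.length + P + T + S1 M x'.length P T ≤
        (dd + 3) * (x'.length + P + T) + (3 * dd + 2) := by rw [hS]; nlinarith
    have h3 := natPoly_eval_mono q h2
    simp only [eval_comp, eval_add, eval_mul, eval_X, eval_C]
    exact h3
  · rw [Bool.eq_iff_iff, hEe u, intended_blk (List.ofFn u) hJ v, cfgAt_eq_cfgOf]
    exact eq_comm

/-! ### The output variable and the soundness core of `A` -/

section Core

variable {M : TM2ComputableAux Bool Bool}

/-- `1 ≤ S₁`. [folklore] -/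
theorem one_le_S1 (n P T : ℕ) : 1 ≤ S1 M n P T := by
  have hS : S1 M n P T = 2 * n + 2 + P + dM M * T + 3 * dM M := rfl
  have hd1 : 1 ≤ dM M := by have := depth_lt_dM M; omega
  omega

/-- **The output variable under the intended assignment**: if `M` halts within `T` steps on
`⟨x', u⟩` with output `[f ⟨x', u⟩]`, the intended tableau assignment of the run makes the variable
"block `1` of row `T` is the accepting value" true exactly when `f ⟨x', u⟩ = 1` (Mathlib's halting
configuration, `absVal_haltList_one`). [cite: Sipser2012, Thm. 7.37 (proof)] -/
theorem intended_outVar {x' u : List Bool} {P T : ℕ} {f : List Bool → Bool}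
    (hrun : M.OutputsWithin (boolPair x' u) [f (boolPair x' u)] T) :
    intended (M := M) x' P T u (blk M x'.length P T T 1, accVal M) = f (boolPair x' u) := by
  rw [Bool.eq_iff_iff, intended_blk u (one_le_S1 _ _ _), cfgAt_eq_haltList hrun, absVal_haltList_one]
  simp only [accVal, List.getElem?_cons_zero, Prod.mk.injEq, true_and]
  constructor
  · intro h
    have hgood : TM2Sim.Good M.tm (cfgAt M x' u T) := good_cfgAt x' u T
    rw [cfgAt_eq_haltList hrun, TM2Comp.haltList_eq] at hgood
    have hsym : TM2Sim.IsSym M.tm M.tm.k₁ (M.outputAlphabet.symm (f (boolPair x' u))) :=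
      hgood M.tm.k₁ _ (by simp)
    exact (M.outputAlphabet.symm.injective (outCell_some_inj hsym h.symm)).symm ▸ rfl
  · intro h
    rw [h]

/-- **The soundness core of the generator** (Williams 2014, proof of Lemma 3.1: "if VALUE is
unsatisfiable then `E` encodes the computation … and `C'ₓ` is correct"). Let `M` print `[f w]`
within `T` steps on `w = ⟨x₀, u⟩` and on `w = ⟨x₁, u⟩`, `|u| = P`. If a bit `g` guards two
tableau assignments — when `g = 1`, `τ₀` satisfies every Cook–Levin clause of `M` on `x₀` and is
pinned to `u`; when `g = 0`, `τ₁` does so on `x₁` — then `f ⟨x₀, u⟩ = 1` if `g = 1` and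
`f ⟨x₁, u⟩ = 1` if `g = 0` (`accepts_of_pinned` on the active side).
[cite: Williams2014, Lemma 3.1 (proof)] -/
theorem checks_sound {x₀ x₁ u : List Bool} {P T : ℕ} (hu : u.length = P) {f : List Bool → Bool}
    (h₀ : M.OutputsWithin (boolPair x₀ u) [f (boolPair x₀ u)] T)
    (h₁ : M.OutputsWithin (boolPair x₁ u) [f (boolPair x₁ u)] T)
    {τ₀ τ₁ : TVar M → Bool} {g : Bool}
    (hg₁ : g = true → (∀ cl ∈ clauses M P T x₀, HClause.Holds τ₀ cl) ∧ Pinned τ₀ x₀ P T u)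
    (hg₀ : g = false → (∀ cl ∈ clauses M P T x₁, HClause.Holds τ₁ cl) ∧ Pinned τ₁ x₁ P T u) :
    (g = true → f (boolPair x₀ u) = true) ∧ (g = false → f (boolPair x₁ u) = true) :=
  ⟨fun hg => accepts_of_pinned (hg₁ hg).1 hu (hg₁ hg).2 h₀,
    fun hg => accepts_of_pinned (hg₀ hg).1 hu (hg₀ hg).2 h₁⟩

/-- **The guarded checks determine the clause bit.** For the clause-bit machine (`bitFun`,
instance words `xq`): if `g` guards the tableau of the run on `⟨x'_{κ,0}, i⟩` when `g = 1` and of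
the run on `⟨x'_{κ,1}, i⟩` when `g = 0`, then `g` is coordinate `κ` of the clause map of `cl x` at
`i` — so an unsatisfiable VALUE forces the guessed output circuit to be correct.
[cite: Williams2014, Lemma 3.1 (proof)] -/
theorem clauseMap_eq_of_checks {cl : List Bool → ℕ → Clause ℕ} {c : ℕ} {x : List Bool}
    (κ : ClauseCoord (succinctWidth c x.length)) (i : Fin (succinctWidth c x.length) → Bool) {T : ℕ}
    (hrun : ∀ pol, M.OutputsWithin (boolPair (MachineA.xq c x κ pol) (List.ofFn i))
      [MachineA.bitFun cl (boolPair (MachineA.xq c x κ pol) (List.ofFn i))] T)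
    {τ₀ τ₁ : TVar M → Bool} {g : Bool}
    (hg₁ : g = true → (∀ cl' ∈ clauses M (succinctWidth c x.length) T (MachineA.xq c x κ false),
      HClause.Holds τ₀ cl') ∧ Pinned τ₀ (MachineA.xq c x κ false) (succinctWidth c x.length) T (List.ofFn i))
    (hg₀ : g = false → (∀ cl' ∈ clauses M (succinctWidth c x.length) T (MachineA.xq c x κ true),
      HClause.Holds τ₁ cl') ∧ Pinned τ₁ (MachineA.xq c x κ true) (succinctWidth c x.length) T (List.ofFn i)) :
    g = clauseMap _ (cl x) i κ := by
  have h := checks_sound (M := M) (List.length_ofFn (f := i)) (hrun false) (hrun true) hg₁ hg₀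
  rw [MachineA.bitFun_xq, MachineA.bitFun_xq] at h
  cases g
  · have := h.2 rfl
    revert this
    cases clauseMap _ (cl x) i κ <;> simp
  · have := h.1 rfl
    revert this
    cases clauseMap _ (cl x) i κ <;> simp

end Core

end Tableau

end Literature.Computability.Complexity
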